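import Summits.CriticalPhenomena.Ising3DConformalLimit.Theorems.EnergyNotSigmaSquaredMoebiusLimitExistsSepMoveAux
import Summits.CriticalPhenomena.Ising3DConformalLimit.Theorems.EnergyNotSigmaSquaredMoebiusLimitExistsMoveIneq
import Summits.CriticalPhenomena.Ising3DConformalLimit.Theorems.EnergyNotSigmaSquaredMoebiusLimitExistsPinnedTwoPoint
import HarnessLib

/-!
# The base case of the pedigree induction from PAIR REGULARITY: asymptotic equicontinuity of the pinned zoom
# under moves of a coordinate-separated point, without the two-point law
(stub F2 `stub_sepMove_of_pairRegularity` of line `Sketch`, crux `ExistsScaleCovariantLimit`,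
item stmt-CriticalPhenomena-1981, route `HyperoctahedralRP`; lead c4, 2026-08-16)

Crux 1344's `sepMove_equicontinuity` (`…MoebiusLimitExistsSepMove.lean`) proves, under the two-point LAW
`⟨σ₀σ_y⟩_{β_c}‖y‖₂^{2Δ} → c > 0` (item 0634), that along a mesh sequence `u k → 0⁺` the pinned rescaled critical
correlators `F_k = ρ_pin(u k)ᴺ⟨∏σ_{[x_j/u k]}⟩_{β_c}` are asymptotically equicontinuous, on compact sets of non-coincident
configurations, under moves of ONE point separated from all the others by a coordinate slab of width `κ`. The law enters
that proof twice: (i) the bracket `ρ²G(v₀) − 2ρ²G(v₁) + ρ²G(v₂)` of the reflection-positivity move inequality tends to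
`0` because the three rescaled two-point terms CONVERGE to a common limit; (ii) the doubled factor `ρ^{2n}⟨σ_{θB}σ_B⟩`
is eventually bounded by `pinnedZoomLocallyBounded`. Here the same conclusion is obtained from PAIR REGULARITY only:
(i′) each term `ρ_pin(δ)²G(a − θb)` is EXACTLY the pinned pair zoom at the pair configuration `(δ·θb, δ·a)`
(`latticeApprox_smul_siteVec`, `criticalCorr_two_pair`), the three pair configurations converge to the common
non-coincident pair `(θ_∞ x₀ i, x₀ i)`, and asymptotic EQUICONTINUITY of the pair zoom on a compact ball around it makes
the bracket `[F₂(P₀) − F₂(P₁)] − [F₂(P₁) − F₂(P₂)]` tend to `0`; (ii′) local bounds at every order are a hypothesis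
(they follow from pair bounds by Newman's Gaussian inequality: stub F1). With F1 and F3 of the line this shows that
item 5955 `OrbitPrecompact` (compactness of the critical zoom at ALL orders) follows from uniform regularity of the
PAIR zoom alone (item 4658 restricted to `n = 2`).
-- adapted from Theorems/EnergyNotSigmaSquaredMoebiusLimitExistsSepMove.lean (line only-interaction-breaks-moebius,
-- crux MoebiusLimitExists), with the two law-uses replaced as described.

References: J. Fröhlich, R. Israel, E. H. Lieb, B. Simon, Comm. Math. Phys. 62 (1978) §2 [FILS1978]; H. Duminil-Copin,
ICM 2022 §8.1 [DuminilCopinICM2022]. No definitions, no `sorry`.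
-/

noncomputable section

namespace Summit.CriticalPhenomena.Ising3DConformalLimit.Cruxes.ExistsScaleCovariantLimit.TwoHierarchies

open Literature.Probability.LatticeModels Filter Set Function
open scoped Topology
open Summit.CriticalPhenomena.Ising3DConformalLimit.MoebiusLimitExistsOnlyInteraction

/-! ### Two elementary lemmas -/

/-- **Asymptotic equicontinuity along two convergent sequences of points.** If `G k` is asymptotically equicontinuous
on a set `K` that is a neighbourhood of `p₀`, and `P j, Q j → p₀`, then `G j (P j) − G j (Q j) → 0`. [folklore] -/
theorem tendsto_sub_of_asympEquicont {X : Type*} [PseudoMetricSpace X] {G : ℕ → X → ℝ} {K : Set X} {p₀ : X}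
    (hK : K ∈ 𝓝 p₀)
    (hE : ∀ ε > 0, ∃ η > 0, ∀ᶠ k in atTop, ∀ x ∈ K, ∀ y ∈ K, dist x y < η → |G k x - G k y| < ε)
    {P Q : ℕ → X} (hP : Tendsto P atTop (𝓝 p₀)) (hQ : Tendsto Q atTop (𝓝 p₀)) :
    Tendsto (fun j => G j (P j) - G j (Q j)) atTop (𝓝 0) := by
  rw [Metric.tendsto_nhds]
  intro ε hε
  obtain ⟨η, hη, hev⟩ := hE ε hε
  have hPK : ∀ᶠ j in atTop, P j ∈ K := hP.eventually_mem hK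
  have hQK : ∀ᶠ j in atTop, Q j ∈ K := hQ.eventually_mem hK
  have hPd : ∀ᶠ j in atTop, dist (P j) p₀ < η / 2 := Metric.tendsto_nhds.1 hP _ (half_pos hη)
  have hQd : ∀ᶠ j in atTop, dist (Q j) p₀ < η / 2 := Metric.tendsto_nhds.1 hQ _ (half_pos hη)
  filter_upwards [hev, hPK, hQK, hPd, hQd] with j hj hPj hQj hPdj hQdj
  have hdist : dist (P j) (Q j) < η := by
    have := dist_triangle_right (P j) (Q j) p₀
    linarith
  rw [Real.dist_eq, sub_zero]
  exact hj _ hPj _ hQj hdist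

/-- **The rescaled two-point term of the move inequality is a value of the pinned PAIR zoom**: for `δ > 0` and lattice
points `a, b`, `ρ_pin(δ)²⟨σ₀σ_{a − b}⟩_{β_c} = F₂(δ)(δ·b, δ·a)` (`[δv/δ] = v`, `⟨σ_bσ_a⟩ = ⟨σ₀σ_{a−b}⟩`). [folklore] -/
theorem rhoPin_sq_mul_criticalTwoPoint_eq_pairZoom {δ : ℝ} (hδ : 0 < δ) (a b : Site 3) :
    rhoPin δ ^ 2 * criticalTwoPoint 3 (a - b) =
      rescaledCorrelator (criticalCorr 3) rhoPin 2 δ (![δ • siteVec b, δ • siteVec a]) := by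
  rw [rescaledCorrelator_rhoPin_two, rhoPin_sq, inv_mul_eq_div]
  simp only [Matrix.cons_val_zero, Matrix.cons_val_one]
  rw [latticeApprox_smul_siteVec hδ, latticeApprox_smul_siteVec hδ]

/-! ### The sequential core -/

/-- **Sequential core of the RP transfer, from pair regularity.** Along a mesh sequence `u j → 0⁺` with local bounds at
order `n + n` and asymptotic equicontinuity of the pinned pair zoom, for configurations `x_j, x'_j → x₀` (non-coincident)
differing only at `i`, lattice mirror heights `c_j` with `u_j c_j → m₀ ≠ x₀ i τ`, all other limit points on one strict
side of `{p_τ = m₀}`, and the lattice side conditions of the move inequality holding eventually: `F_j x_j − F_j x'_j → 0`.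
The bracket `ρ²G(v₀) − 2ρ²G(v₁) + ρ²G(v₂)` is `[F₂(P₀ʲ) − F₂(P₁ʲ)] − [F₂(P₁ʲ) − F₂(P₂ʲ)]` for three pair configurations
tending to `(θ_∞ x₀ i, x₀ i) ∈ NonCoincident 3 2`, hence tends to `0` by pair equicontinuity on a compact ball there
(`tendsto_sub_of_asympEquicont`); the doubled factor is the pinned zoom at the lifts `u_j(θB_j, B_j) → (θ_∞B₀, B₀)`,
a non-coincident configuration (`doubled_mem_nonCoincident`), eventually bounded by the local bounds on a compact ball.
[cite: FILS1978, §2] -/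
theorem tendsto_sub_of_move_pr {u : ℕ → ℝ} (hu : Tendsto u atTop (𝓝[>] (0 : ℝ))) {n : ℕ}
    (hLB : ∀ (K : Set (Fin (n + n) → EuclideanSpace ℝ (Fin 3))), IsCompact K → K ⊆ NonCoincident 3 (n + n) →
      ∃ M : ℝ, ∀ᶠ k in atTop, ∀ x ∈ K, |rescaledCorrelator (criticalCorr 3) rhoPin (n + n) (u k) x| ≤ M)
    (hE : ∀ K : Set (Fin 2 → EuclideanSpace ℝ (Fin 3)), IsCompact K → K ⊆ NonCoincident 3 2 →
      ∀ ε > 0, ∃ η > 0, ∀ᶠ k in atTop, ∀ x ∈ K, ∀ y ∈ K, dist x y < η →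
        |rescaledCorrelator (criticalCorr 3) rhoPin 2 (u k) x -
          rescaledCorrelator (criticalCorr 3) rhoPin 2 (u k) y| < ε)
    (i : Fin (n + 1)) (τ : Fin 3)
    (hMove : ∀ (c : ℤ) (y y' : Fin (n + 1) → Site 3),
      (∀ j, j ≠ i → y' j = y j) →
      ((y i τ ≤ c ∧ y' i τ ≤ c ∧ ∀ j, j ≠ i → c ≤ y j τ) ∨
        (c ≤ y i τ ∧ c ≤ y' i τ ∧ ∀ j, j ≠ i → y j τ ≤ c)) →
      (criticalCorr 3 (n + 1) y - criticalCorr 3 (n + 1) y') ^ 2 ≤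
        (criticalTwoPoint 3 (y i - Function.update (y i) τ (2 * c - y i τ))
          - 2 * criticalTwoPoint 3 (y i - Function.update (y' i) τ (2 * c - y' i τ))
          + criticalTwoPoint 3 (y' i - Function.update (y' i) τ (2 * c - y' i τ))) *
        criticalCorr 3 (n + n)
          (Fin.append (fun j => Function.update (y (i.succAbove j)) τ (2 * c - y (i.succAbove j) τ))
            (fun j => y (i.succAbove j))))
    {x x' : ℕ → Fin (n + 1) → EuclideanSpace ℝ (Fin 3)} {x₀ : Fin (n + 1) → EuclideanSpace ℝ (Fin 3)}
    (hx : Tendsto x atTop (𝓝 x₀)) (hx' : Tendsto x' atTop (𝓝 x₀)) (hinj : Injective x₀)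
    (hdiff : ∀ j l, l ≠ i → x' j l = x j l) {cs : ℕ → ℤ} {m₀ : ℝ}
    (hcs : Tendsto (fun j => u j * (cs j : ℝ)) atTop (𝓝 m₀)) (hm₀ : x₀ i τ ≠ m₀)
    (hside₀ : (∀ l, l ≠ i → m₀ < x₀ l τ) ∨ (∀ l, l ≠ i → x₀ l τ < m₀))
    (hside : ∀ᶠ j in atTop,
      (latticeApprox (u j) (x j i) τ ≤ cs j ∧ latticeApprox (u j) (x' j i) τ ≤ cs j ∧
          ∀ l, l ≠ i → cs j ≤ latticeApprox (u j) (x j l) τ) ∨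
        (cs j ≤ latticeApprox (u j) (x j i) τ ∧ cs j ≤ latticeApprox (u j) (x' j i) τ ∧
          ∀ l, l ≠ i → latticeApprox (u j) (x j l) τ ≤ cs j)) :
    Tendsto (fun j => rescaledCorrelator (criticalCorr 3) rhoPin (n + 1) (u j) (x j) -
      rescaledCorrelator (criticalCorr 3) rhoPin (n + 1) (u j) (x' j)) atTop (𝓝 0) := by
  -- adapted from …MoebiusLimitExistsSepMove.lean `tendsto_sub_of_move` (line only-interaction-breaks-moebius)
  have hupos : ∀ᶠ j in atTop, 0 < u j := (tendsto_nhdsWithin_iff.1 hu).2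
  -- rescaled coordinates of the lattice approximations converge
  have hco : ∀ z : ℕ → Fin (n + 1) → EuclideanSpace ℝ (Fin 3), Tendsto z atTop (𝓝 x₀) →
      ∀ l q, Tendsto (fun j => u j * (latticeApprox (u j) (z j l) q : ℝ)) atTop (𝓝 (x₀ l q)) := by
    intro z hz l q
    have hc' : Continuous fun w : Fin (n + 1) → EuclideanSpace ℝ (Fin 3) => w l q := by fun_prop
    have h := tendsto_mul_floor_div hu ((hc'.tendsto x₀).comp hz)
    simpa only [latticeApprox_apply, Function.comp_def] using h
  -- FIRST FACTOR: the three rescaled two-point terms are pair zooms at pair configurations with a common limit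
  -- the limiting pair `P₀ = (θ_∞ x₀ i, x₀ i)` and a compact ball around it inside `NonCoincident 3 2`
  obtain ⟨P₀, hP₀⟩ : ∃ P₀ : Fin 2 → EuclideanSpace ℝ (Fin 3), P₀ =
      ![(WithLp.toLp 2 fun q => if q = τ then 2 * m₀ - x₀ i τ else x₀ i q : EuclideanSpace ℝ (Fin 3)),
        x₀ i] := ⟨_, rfl⟩
  have hP₀mem : P₀ ∈ NonCoincident 3 2 := by
    rw [hP₀]
    refine pair_mem_nonCoincident fun h => hm₀ ?_
    have h' := congrArg (fun v : EuclideanSpace ℝ (Fin 3) => v τ) h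
    simp only [if_true] at h'
    linarith
  obtain ⟨ε₂, hε₂, hball₂⟩ := Metric.isOpen_iff.1 (isOpen_nonCoincident 3 2) P₀ hP₀mem
  have hK₂c : IsCompact (Metric.closedBall P₀ (ε₂ / 2)) := isCompact_closedBall P₀ (ε₂ / 2)
  have hK₂s : Metric.closedBall P₀ (ε₂ / 2) ⊆ NonCoincident 3 2 :=
    (Metric.closedBall_subset_ball (half_lt_self hε₂)).trans hball₂
  have hK₂n : Metric.closedBall P₀ (ε₂ / 2) ∈ 𝓝 P₀ := Metric.closedBall_mem_nhds P₀ (half_pos hε₂)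
  -- the pair configurations built from two sequences of lattice points and their convergence to `P₀`
  have hPconv : ∀ a b : ℕ → Site 3,
      (∀ q, Tendsto (fun j => u j * (a j q : ℝ)) atTop (𝓝 (x₀ i q))) →
      (∀ q, Tendsto (fun j => u j * (b j q : ℝ)) atTop (𝓝 (x₀ i q))) →
      Tendsto (fun j => (![u j • siteVec (Function.update (b j) τ (2 * cs j - b j τ)), u j • siteVec (a j)] :
        Fin 2 → EuclideanSpace ℝ (Fin 3))) atTop (𝓝 P₀) := by
    intro a b ha hb
    rw [hP₀]
    refine tendsto_pi_nhds.2 fun l => ?_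
    refine Fin.cases ?_ (fun l' => ?_) l
    · simp only [Matrix.cons_val_zero]
      refine tendsto_euclidean_of_apply fun q => ?_
      simp only [PiLp.smul_apply, siteVec_apply, smul_eq_mul]
      exact tendsto_mul_update_apply τ hb hcs q
    · have hl' : l' = 0 := Subsingleton.elim _ _
      subst hl'
      simp only [Matrix.cons_val_succ, Matrix.cons_val_zero]
      refine tendsto_euclidean_of_apply fun q => ?_
      simp only [PiLp.smul_apply, siteVec_apply, smul_eq_mul]
      exact ha q
  -- differences of two such terms tend to `0` by pair equicontinuity on the ball
  have hpairE : ∀ a b a' b' : ℕ → Site 3,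
      (∀ q, Tendsto (fun j => u j * (a j q : ℝ)) atTop (𝓝 (x₀ i q))) →
      (∀ q, Tendsto (fun j => u j * (b j q : ℝ)) atTop (𝓝 (x₀ i q))) →
      (∀ q, Tendsto (fun j => u j * (a' j q : ℝ)) atTop (𝓝 (x₀ i q))) →
      (∀ q, Tendsto (fun j => u j * (b' j q : ℝ)) atTop (𝓝 (x₀ i q))) →
      Tendsto (fun j => rhoPin (u j) ^ 2 *
          criticalTwoPoint 3 (a j - Function.update (b j) τ (2 * cs j - b j τ)) -
        rhoPin (u j) ^ 2 *
          criticalTwoPoint 3 (a' j - Function.update (b' j) τ (2 * cs j - b' j τ))) atTop (𝓝 0) := by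
    intro a b a' b' ha hb ha' hb'
    have h := tendsto_sub_of_asympEquicont hK₂n (hE _ hK₂c hK₂s) (hPconv a b ha hb) (hPconv a' b' ha' hb')
    refine h.congr' ?_
    filter_upwards [hupos] with j hj
    rw [rhoPin_sq_mul_criticalTwoPoint_eq_pairZoom hj, rhoPin_sq_mul_criticalTwoPoint_eq_pairZoom hj]
  have hxi := hco x hx i
  have hx'i := hco x' hx' i
  have hA := (hpairE _ _ _ _ hxi hxi hxi hx'i).sub (hpairE _ _ _ _ hxi hx'i hx'i hx'i)
  rw [sub_zero] at hA
  have hA' : Tendsto (fun j =>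
      rhoPin (u j) ^ 2 * criticalTwoPoint 3 (latticeApprox (u j) (x j i) -
          Function.update (latticeApprox (u j) (x j i)) τ (2 * cs j - latticeApprox (u j) (x j i) τ)) -
        2 * (rhoPin (u j) ^ 2 * criticalTwoPoint 3 (latticeApprox (u j) (x j i) -
          Function.update (latticeApprox (u j) (x' j i)) τ (2 * cs j - latticeApprox (u j) (x' j i) τ))) +
        rhoPin (u j) ^ 2 * criticalTwoPoint 3 (latticeApprox (u j) (x' j i) -
          Function.update (latticeApprox (u j) (x' j i)) τ (2 * cs j - latticeApprox (u j) (x' j i) τ)))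
      atTop (𝓝 0) := by
    refine hA.congr fun j => ?_
    ring
  -- SECOND FACTOR: the doubled configuration, its lifts and their limit
  obtain ⟨Zl, hZl⟩ : ∃ Zl : ℕ → Fin (n + n) → Site 3, ∀ j, Zl j = Fin.append
      (fun l => Function.update (latticeApprox (u j) (x j (i.succAbove l))) τ
        (2 * cs j - latticeApprox (u j) (x j (i.succAbove l)) τ))
      (fun l => latticeApprox (u j) (x j (i.succAbove l))) := ⟨_, fun _ => rfl⟩
  obtain ⟨Z₀, hZ₀⟩ : ∃ Z₀ : Fin (n + n) → EuclideanSpace ℝ (Fin 3), Z₀ = Fin.append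
      (fun l => (WithLp.toLp 2 fun q => if q = τ then 2 * m₀ - x₀ (i.succAbove l) τ
        else x₀ (i.succAbove l) q : EuclideanSpace ℝ (Fin 3)))
      (fun l => x₀ (i.succAbove l)) := ⟨_, rfl⟩
  have hZlim : Tendsto (fun j => fun a => (u j • siteVec (Zl j a) : EuclideanSpace ℝ (Fin 3)))
      atTop (𝓝 Z₀) := by
    refine tendsto_pi_nhds.2 fun a => tendsto_euclidean_of_apply fun q => ?_
    simp only [PiLp.smul_apply, siteVec_apply, smul_eq_mul, hZl, hZ₀]
    induction a using Fin.addCases with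
    | left l =>
      simp only [Fin.append_left, PiLp.toLp_apply]
      exact tendsto_mul_update_apply τ (hco x hx (i.succAbove l)) hcs q
    | right l =>
      simp only [Fin.append_right]
      exact hco x hx (i.succAbove l) q
  have hZ₀mem : Z₀ ∈ NonCoincident 3 (n + n) := hZ₀ ▸ doubled_mem_nonCoincident i τ hinj hside₀
  obtain ⟨ε₀, hε₀, hball⟩ := Metric.isOpen_iff.1 (isOpen_nonCoincident 3 (n + n)) Z₀ hZ₀mem
  obtain ⟨B, hB⟩ := hLB (Metric.closedBall Z₀ (ε₀ / 2)) (isCompact_closedBall Z₀ (ε₀ / 2))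
    ((Metric.closedBall_subset_ball (half_lt_self hε₀)).trans hball)
  have hmem : ∀ᶠ j in atTop, (fun a => (u j • siteVec (Zl j a) : EuclideanSpace ℝ (Fin 3))) ∈
      Metric.closedBall Z₀ (ε₀ / 2) :=
    hZlim.eventually_mem (Metric.closedBall_mem_nhds Z₀ (half_pos hε₀))
  have hbound : ∀ᶠ j in atTop, |rhoPin (u j) ^ (n + n) * criticalCorr 3 (n + n) (Zl j)| ≤ B := by
    filter_upwards [hB, hmem, hupos] with j hBj hmj hposj
    have h := hBj _ hmj
    simp only [rescaledCorrelator_apply, latticeApprox_smul_siteVec hposj] at h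
    exact h
  -- COMBINATION
  have hsq : Tendsto (fun j => (rescaledCorrelator (criticalCorr 3) rhoPin (n + 1) (u j) (x j) -
      rescaledCorrelator (criticalCorr 3) rhoPin (n + 1) (u j) (x' j)) ^ 2) atTop (𝓝 0) := by
    refine squeeze_zero' (Eventually.of_forall fun j => sq_nonneg _) ?_
      (by simpa using hA'.abs.mul_const B)
    filter_upwards [hside, hbound] with j hsj hbj
    have h := sq_rescaled_sub_le_of_move i τ hMove (u j) (cs j) (x j) (x' j) (hdiff j) hsj
    rw [← hZl j] at h
    refine h.trans ((le_abs_self _).trans ?_)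
    rw [abs_mul]
    exact mul_le_mul_of_nonneg_left hbj (abs_nonneg _)
  rw [tendsto_zero_iff_abs_tendsto_zero]
  have h := hsq.sqrt
  rw [Real.sqrt_zero] at h
  exact h.congr fun j => Real.sqrt_sq_eq_abs _

/-- **Sequential form, fixed orientation.** Along a mesh sequence with local bounds and pair equicontinuity, for
configurations `x_j, x'_j → x₀` (non-coincident) differing only at `i`, with `x_j i` separated from the other points of
`x_j` by a slab of width `κ` in coordinate `τ`: `F_j x_j − F_j x'_j → 0` — the core with the mirror at
`c_j = ⌊(x_j i τ ± κ/2)/u_j⌋`. [cite: FILS1978, §2] -/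
theorem tendsto_sub_of_separated_pr {u : ℕ → ℝ} (hu : Tendsto u atTop (𝓝[>] (0 : ℝ))) {n : ℕ}
    (hLB : ∀ (K : Set (Fin (n + n) → EuclideanSpace ℝ (Fin 3))), IsCompact K → K ⊆ NonCoincident 3 (n + n) →
      ∃ M : ℝ, ∀ᶠ k in atTop, ∀ x ∈ K, |rescaledCorrelator (criticalCorr 3) rhoPin (n + n) (u k) x| ≤ M)
    (hE : ∀ K : Set (Fin 2 → EuclideanSpace ℝ (Fin 3)), IsCompact K → K ⊆ NonCoincident 3 2 →
      ∀ ε > 0, ∃ η > 0, ∀ᶠ k in atTop, ∀ x ∈ K, ∀ y ∈ K, dist x y < η →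
        |rescaledCorrelator (criticalCorr 3) rhoPin 2 (u k) x -
          rescaledCorrelator (criticalCorr 3) rhoPin 2 (u k) y| < ε)
    (i : Fin (n + 1)) (τ : Fin 3) {κ : ℝ} (hκ : 0 < κ)
    {x x' : ℕ → Fin (n + 1) → EuclideanSpace ℝ (Fin 3)} {x₀ : Fin (n + 1) → EuclideanSpace ℝ (Fin 3)}
    (hx : Tendsto x atTop (𝓝 x₀)) (hx' : Tendsto x' atTop (𝓝 x₀)) (hinj : Injective x₀)
    (hdiff : ∀ j l, l ≠ i → x' j l = x j l)
    (hsep : (∀ j l, l ≠ i → x j i τ + κ ≤ x j l τ) ∨ (∀ j l, l ≠ i → x j l τ + κ ≤ x j i τ)) :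
    Tendsto (fun j => rescaledCorrelator (criticalCorr 3) rhoPin (n + 1) (u j) (x j) -
      rescaledCorrelator (criticalCorr 3) rhoPin (n + 1) (u j) (x' j)) atTop (𝓝 0) := by
  -- adapted from …MoebiusLimitExistsSepMove.lean `tendsto_sub_of_separated` (line only-interaction-breaks-moebius)
  have hupos : ∀ᶠ j in atTop, 0 < u j := (tendsto_nhdsWithin_iff.1 hu).2
  have hco : ∀ z : ℕ → Fin (n + 1) → EuclideanSpace ℝ (Fin 3), Tendsto z atTop (𝓝 x₀) →
      ∀ l q, Tendsto (fun j => z j l q) atTop (𝓝 (x₀ l q)) := by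
    intro z hz l q
    have hc' : Continuous fun w : Fin (n + 1) → EuclideanSpace ℝ (Fin 3) => w l q := by fun_prop
    exact (hc'.tendsto x₀).comp hz
  have hnear : ∀ᶠ j in atTop, |x' j i τ - x j i τ| < κ / 2 := by
    have h := ((hco x' hx' i τ).sub (hco x hx i τ)).abs
    rw [sub_self, abs_zero] at h
    exact h.eventually (gt_mem_nhds (half_pos hκ))
  have hMove := moveIneq_latticeRP τ
  rcases hsep with hsep | hsep
  · -- the moving point BELOW the others: mirror at `m₀ = x₀ i τ + κ/2`
    refine tendsto_sub_of_move_pr hu hLB hE i τ (fun c => hMove c n i) hx hx' hinj hdiff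
      (cs := fun j => ⌊(x j i τ + κ / 2) / u j⌋) (m₀ := x₀ i τ + κ / 2)
      (tendsto_mul_floor_div hu ((hco x hx i τ).add_const _)) (fun h => by linarith)
      (Or.inl fun l hl => ?_) ?_
    · have hlim : x₀ i τ + κ ≤ x₀ l τ := le_of_tendsto_of_tendsto ((hco x hx i τ).add_const κ)
        (hco x hx l τ) (Eventually.of_forall fun j => hsep j l hl)
      linarith
    · filter_upwards [hupos, hnear] with j hpos hnj
      refine Or.inl ⟨?_, ?_, fun l hl => ?_⟩ <;> rw [latticeApprox_apply] <;>
        refine Int.floor_le_floor (div_le_div_of_nonneg_right ?_ hpos.le)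
      · linarith
      · linarith [(abs_lt.1 hnj).2]
      · linarith [hsep j l hl]
  · -- the moving point ABOVE the others: mirror at `m₀ = x₀ i τ - κ/2`
    refine tendsto_sub_of_move_pr hu hLB hE i τ (fun c => hMove c n i) hx hx' hinj hdiff
      (cs := fun j => ⌊(x j i τ - κ / 2) / u j⌋) (m₀ := x₀ i τ - κ / 2)
      (tendsto_mul_floor_div hu ((hco x hx i τ).sub_const _)) (fun h => by linarith)
      (Or.inr fun l hl => ?_) ?_
    · have hlim : x₀ l τ + κ ≤ x₀ i τ := le_of_tendsto_of_tendsto ((hco x hx l τ).add_const κ)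
        (hco x hx i τ) (Eventually.of_forall fun j => hsep j l hl)
      linarith
    · filter_upwards [hupos, hnear] with j hpos hnj
      refine Or.inr ⟨?_, ?_, fun l hl => ?_⟩ <;> rw [latticeApprox_apply] <;>
        refine Int.floor_le_floor (div_le_div_of_nonneg_right ?_ hpos.le)
      · linarith
      · linarith [(abs_lt.1 hnj).1]
      · linarith [hsep j l hl]

/-! ### The registered stub -/

/-- **F2 (registered stub of line `Sketch`) — THE BASE CASE OF THE PEDIGREE INDUCTION FROM PAIR REGULARITY.**
If along every mesh sequence `u k → 0⁺` the pinned zoom is eventually bounded on compacts at every order, and the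
pinned PAIR zoom is asymptotically equicontinuous on every compact set of non-coincident pairs, then along every mesh
sequence, on every compact set `K` of non-coincident `N`-point configurations, for every margin `κ > 0`, index `i`,
coordinate `τ` and `ε > 0` there is `η > 0` such that eventually in `k`, `|F_k x − F_k x'| < ε` whenever `x, x' ∈ K`
differ only at `i`, `dist x x' < η`, and `x i` is separated from all the other points by a slab of width `κ` in
coordinate `τ`. By contradiction along sequences (`equicontinuity_of_seq`, one orientation at a time) and
`tendsto_sub_of_separated_pr` along the extracted subsequence `u ∘ φ` (the hypotheses are used along `u ∘ φ → 0⁺`);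
the RP move inequality is the landed `moveIneq_latticeRP`; `N = 0` is vacuous. [cite: FILS1978, §2] -/
theorem stub_sepMove_of_pairRegularity :
    (∀ u : ℕ → ℝ, Tendsto u atTop (𝓝[>] (0 : ℝ)) →
      ∀ (n : ℕ) (K : Set (Fin n → EuclideanSpace ℝ (Fin 3))), IsCompact K → K ⊆ NonCoincident 3 n →
        ∃ M : ℝ, ∀ᶠ k in atTop, ∀ x ∈ K, |rescaledCorrelator (criticalCorr 3) rhoPin n (u k) x| ≤ M) →
    (∀ u : ℕ → ℝ, Tendsto u atTop (𝓝[>] (0 : ℝ)) →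
      ∀ K : Set (Fin 2 → EuclideanSpace ℝ (Fin 3)), IsCompact K → K ⊆ NonCoincident 3 2 →
        ∀ ε > 0, ∃ η > 0, ∀ᶠ k in atTop, ∀ x ∈ K, ∀ y ∈ K, dist x y < η →
          |rescaledCorrelator (criticalCorr 3) rhoPin 2 (u k) x -
            rescaledCorrelator (criticalCorr 3) rhoPin 2 (u k) y| < ε) →
    ∀ u : ℕ → ℝ, Tendsto u atTop (𝓝[>] (0 : ℝ)) →
      ∀ (N : ℕ) (K : Set (Fin N → EuclideanSpace ℝ (Fin 3))), IsCompact K → K ⊆ NonCoincident 3 N →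
        ∀ κ : ℝ, 0 < κ → ∀ (i : Fin N) (τ : Fin 3), ∀ ε > 0, ∃ η > 0, ∀ᶠ k in atTop, ∀ x ∈ K, ∀ x' ∈ K,
          (∀ j, j ≠ i → x' j = x j) →
          ((∀ j, j ≠ i → x i τ + κ ≤ x j τ) ∨ (∀ j, j ≠ i → x j τ + κ ≤ x i τ)) →
          dist x x' < η →
            |rescaledCorrelator (criticalCorr 3) rhoPin N (u k) x -
              rescaledCorrelator (criticalCorr 3) rhoPin N (u k) x'| < ε := by
  -- adapted from …MoebiusLimitExistsSepMove.lean `sepMove_equicontinuity` (line only-interaction-breaks-moebius)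
  intro hLB hE u hu N K hK hKs κ hκ i τ ε hε
  cases N with
  | zero => exact i.elim0
  | succ n =>
    -- one orientation at a time, by contradiction along sequences
    have key : ∀ S : (Fin (n + 1) → EuclideanSpace ℝ (Fin 3)) → Prop,
        ((S = fun x => ∀ j, j ≠ i → x i τ + κ ≤ x j τ) ∨
          (S = fun x => ∀ j, j ≠ i → x j τ + κ ≤ x i τ)) →
        ∃ η > 0, ∀ᶠ k in atTop, ∀ x ∈ K, ∀ x' ∈ K, ((∀ j, j ≠ i → x' j = x j) ∧ S x) →
          dist x x' < η →
            |rescaledCorrelator (criticalCorr 3) rhoPin (n + 1) (u k) x -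
              rescaledCorrelator (criticalCorr 3) rhoPin (n + 1) (u k) x'| < ε := by
      intro S hS
      refine equicontinuity_of_seq (n + 1) K hK (fun x x' => (∀ j, j ≠ i → x' j = x j) ∧ S x)
        (fun k => rescaledCorrelator (criticalCorr 3) rhoPin (n + 1) (u k)) ?_ ε hε
      intro x x' x₀ hx₀ hP hx hx' φ hφ
      have hu' : Tendsto (u ∘ φ) atTop (𝓝[>] (0 : ℝ)) := hu.comp hφ.tendsto_atTop
      refine tendsto_sub_of_separated_pr (u := u ∘ φ) hu' (hLB (u ∘ φ) hu' (n + n)) (hE (u ∘ φ) hu') i τ hκ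
        hx hx' ((mem_nonCoincident x₀).1 (hKs hx₀)) (fun j => (hP j).1) ?_
      rcases hS with rfl | rfl
      · exact Or.inl fun j => (hP j).2
      · exact Or.inr fun j => (hP j).2
    obtain ⟨η₁, hη₁, h₁⟩ := key _ (Or.inl rfl)
    obtain ⟨η₂, hη₂, h₂⟩ := key _ (Or.inr rfl)
    refine ⟨min η₁ η₂, lt_min hη₁ hη₂, ?_⟩
    filter_upwards [h₁, h₂] with k hk₁ hk₂ x hx x' hx' hdiff hsep hdist
    rcases hsep with hsep | hsep
    · exact hk₁ x hx x' hx' ⟨hdiff, hsep⟩ (lt_of_lt_of_le hdist (min_le_left _ _))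
    · exact hk₂ x hx x' hx' ⟨hdiff, hsep⟩ (lt_of_lt_of_le hdist (min_le_right _ _))

end Summit.CriticalPhenomena.Ising3DConformalLimit.Cruxes.ExistsScaleCovariantLimit.TwoHierarchies

end
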